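import Literature.NumberTheory.Automorphic.LocalConstantsUniquenessDimOne
import Literature.NumberTheory.Automorphic.TateLocalFunctionalEquation
import HarnessLib

/-!
# Deligne's uniqueness theorem for local constants (proved)

Discharge of the named fact `localEpsilonSystem_unique` of `LocalConstants` (Deligne 1973,
*Les constantes des équations fonctionnelles des fonctions L*, Thm. 4.1, uniqueness half;
Tate 1979, *Number theoretic background*, Thm. 3.4.1): two systems of local constants
`𝓔, 𝓔' : LocalEpsilonSystem F` with the same local Artin data agree on every Weil–Deligne
representation `(ρ, N)` of every finite extension `E/F`, for every non-trivial continuous `ψ` and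
every Haar measure.

The proof is the composition of

* `localEpsilonSystem_unique_of_existsUnique_hasTateEpsilon` (`LocalConstantsUniquenessDimOne`):
  Deligne's argument — `ε₀(ρ, 0) ε₀(ρ, N)⁻¹` bookkeeping, reduction to irreducible `ρ`, an
  unramified twist of an irreducible `ρ` factors through a finite quotient `W_E/K`
  (`WeilGroupIrreducibleTwist`), Deligne's form of Brauer's theorem in degree `0`
  (`DegreeZeroInduction`, Deligne 1973, Prop. 1.5), inductivity in degree `0` along
  `W_M → W_E` for the finite extensions `M/E` realised as local fields
  (`LocalFieldFiniteExtension`, `WeilGroupOpenFiniteIndex`, `MonomialInflation`,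
  `LocalConstantsInflation`), and in dimension one the axiom `dim_one` of both systems read
  through local class field theory for `GL₁` — which leaves exactly the EXISTENCE of Tate's local
  constant `ε(s, χ, ψ)` for every quasi-character `χ` of every finite extension `E` of `F`;
* `existsUnique_hasTateEpsilon_holds` (`TateLocalFunctionalEquation`): Tate's local functional
  equation (Tate 1950, Thm. 2.4.1 and §2.5), proved for every non-archimedean local field.

## References

* P. Deligne, *Les constantes des équations fonctionnelles des fonctions L*, in Modular
  functions of one variable II, LNM 349 (1973), §4, Thm. 4.1. [Deligne1973]
* J. Tate, *Number theoretic background*, Proc. Sympos. Pure Math. 33.2 (Corvallis 1979),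
  §3.4, Thm. 3.4.1. [TateCorvallis1979]
* J. Tate, *Fourier analysis in number fields and Hecke's zeta-functions* (1950), in
  Cassels–Fröhlich (1967), Ch. XV, Thm. 2.4.1, §2.5. [Tate1950]
* D. Rohrlich, *Root numbers*, in Arithmetic of `L`-functions, IAS/Park City Math. Ser. 18
  (2011), Lecture 4, §2 (Thm. 4.1 and its proof). [Rohrlich2011]
-/

set_option autoImplicit false

namespace Literature.NumberTheory.Automorphic

variable {F : Type} [Field F] [ValuativeRel F] [TopologicalSpace F] [IsNonarchimedeanLocalField F]

/-- **Deligne's uniqueness theorem for the local constants** — discharge of the named fact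
`localEpsilonSystem_unique` (Deligne 1973, Thm. 4.1; Tate 1979, Thm. 3.4.1): two systems of
local constants over `F` with the same local Artin data coincide.  Deligne's reduction to
dimension one (`localEpsilonSystem_unique_of_existsUnique_hasTateEpsilon`) fed with Tate's local
functional equation (`existsUnique_hasTateEpsilon_holds`) for the quasi-characters of the finite
extensions of `F`. [cite: Deligne1973, Thm. 4.1] -/
theorem localEpsilonSystem_unique_holds : localEpsilonSystem_unique (F := F) :=
  localEpsilonSystem_unique_of_existsUnique_hasTateEpsilon fun _ _ _ _ _ _ _ _ _ ψ μ μ' χ =>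
    existsUnique_hasTateEpsilon_holds ψ μ μ' χ

end Literature.NumberTheory.Automorphic
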